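import Summits.QuantumFields.YangMills.Theorems.ConvexGribovBodyCovarianceBoundDefs

/-!
# Crux `BrascampLiebVacuumSC` (stmt-QuantumFields-16404), line `SketchIdeator1`, skeleton v5:
# the cube witness for groups whose involutions are central

Helper file of the line lead c2 (`prover-line-stmt-QuantumFields-16404-c2-0`). Skeleton v5
(`Cruxes/BrascampLiebVacuumSC/Lines/SketchIdeator1.lean`) derives the volume-uniform Coulomb-gauge floor
from ONE property of the compact group `G` alone, the registered stub `stub_cubeWitness`: some configuration
of some `n × n × n` cube (sites `Fin 3 → Fin n`, links `(x, j)` with `x j + 1 < n`) is not gauge-equivalent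
to an involution-valued one. This file discharges that property for every compact simple `G` all of whose
involutions are central (e.g. `SU(2)`), with `n = 2`: put a non-central `g₀` on the link `(0, e₀)` of the
`2 × 2 × 2` cube and `1` elsewhere; if a cube gauge `k` made all twelve links involutions, hence central, the
gauge-transformed holonomy `k(0) g₀ k(0)⁻¹` of the plaquette `(0; e₀, e₁)` — a product of four of them —
would be central, so `g₀` would be central. Hence, through v5, the floor for such `G` (c1's
`floorCore_of_involutions_central`, p128562) is recovered from the cube pipeline; the point of the file is
to certify that the registered encoding of `stub_cubeWitness` is the intended (satisfiable, non-vacuous)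
statement. Elementary; no named facts.
-/

set_option autoImplicit false

open Literature.MathematicalPhysics.QuantumFieldTheory

namespace Summit.QuantumFields.YangMills.Theorems.BrascampLiebVacuumSC

namespace CubeWitness

/-- A conjugate `k g k⁻¹` is central iff `g` is. [folklore] -/
theorem conj_mem_center_iff {G : Type} [Group G] (k g : G) :
    k * g * k⁻¹ ∈ Subgroup.center G ↔ g ∈ Subgroup.center G := by
  constructor
  · intro h
    have hk := Subgroup.mem_center_iff.1 h k
    have h1 : k * g * k⁻¹ = g := by
      have h2 : k * (k * g * k⁻¹) = k * g := by rw [hk]; group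
      exact mul_left_cancel h2
    rw [h1] at h
    exact h
  · intro h
    have hg := Subgroup.mem_center_iff.1 h k
    rw [hg, mul_inv_cancel_right]
    exact h

end CubeWitness

open CubeWitness in
/-- **The cube witness for groups with central involutions** (`stub_cubeWitness` of skeleton v5 at such
`G`, with `n = 2` and without the simple-connectivity hypothesis): if every `g : G` with `g² = 1` is central
and `G` is compact simple (so non-abelian), the configuration of the `2 × 2 × 2` cube carrying a non-central
`g₀` on the link `(0, e₀)` and `1` elsewhere is not gauge-equivalent to an involution-valued configuration.
[folklore] -/
theorem cubeWitness_of_involutions_central :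
    ∀ (G : Type) [Group G] [TopologicalSpace G] [CompactSpace G],
      IsCompactSimpleLieGroup G → (∀ g : G, g * g = 1 → g ∈ Subgroup.center G) →
      ∃ (n : ℕ) (u : (Fin 3 → Fin n) → Fin 3 → G), ∀ k : (Fin 3 → Fin n) → G,
        ∃ (x : Fin 3 → Fin n) (j : Fin 3) (h : (x j : ℕ) + 1 < n),
          k x * u x j * (k (Function.update x j ⟨(x j : ℕ) + 1, h⟩))⁻¹ *
            (k x * u x j * (k (Function.update x j ⟨(x j : ℕ) + 1, h⟩))⁻¹) ≠ 1 := by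
  intro G _ _ _ hG hJ
  classical
  -- a non-central element exists (`G` is non-abelian)
  obtain ⟨g₀, hg₀⟩ : ∃ g₀ : G, g₀ ∉ Subgroup.center G := by
    have hG' := hG.1
    unfold Literature.MathematicalPhysics.QuantumLattice.IsSimpleCompactGroup at hG'
    obtain ⟨-, ⟨a, b, hab⟩, -⟩ := hG'
    exact ⟨a, fun ha => hab ((Subgroup.mem_center_iff.1 ha b).symm)⟩
  -- the `2 × 2 × 2` cube with `g₀` on the link `(0, e₀)`
  refine ⟨2, fun x j => if x = 0 ∧ j = 0 then g₀ else 1, fun k => ?_⟩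
  by_contra hall
  push Not at hall
  -- the four links of the plaquette `(0; e₀, e₁)`: corners `0`, `a = e₀`, `b = e₁`, `c = e₀ + e₁`
  have hv1 : (((0 : Fin 3 → Fin 2) 0 : Fin 2) : ℕ) + 1 < 2 := by decide
  have hv2 : (((![1, 0, 0] : Fin 3 → Fin 2) 1 : Fin 2) : ℕ) + 1 < 2 := by decide
  have hv3 : (((![0, 1, 0] : Fin 3 → Fin 2) 0 : Fin 2) : ℕ) + 1 < 2 := by decide
  have hv4 : (((0 : Fin 3 → Fin 2) 1 : Fin 2) : ℕ) + 1 < 2 := by decide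
  have h1 := hall 0 0 hv1
  have h2 := hall ![1, 0, 0] 1 hv2
  have h3 := hall ![0, 1, 0] 0 hv3
  have h4 := hall 0 1 hv4
  have E1 : Function.update (0 : Fin 3 → Fin 2) 0 ⟨(((0 : Fin 3 → Fin 2) 0 : Fin 2) : ℕ) + 1, hv1⟩ =
      ![1, 0, 0] := by
    funext i; fin_cases i <;> rfl
  have E2 : Function.update (![1, 0, 0] : Fin 3 → Fin 2) 1
      ⟨(((![1, 0, 0] : Fin 3 → Fin 2) 1 : Fin 2) : ℕ) + 1, hv2⟩ = ![1, 1, 0] := by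
    funext i; fin_cases i <;> rfl
  have E3 : Function.update (![0, 1, 0] : Fin 3 → Fin 2) 0
      ⟨(((![0, 1, 0] : Fin 3 → Fin 2) 0 : Fin 2) : ℕ) + 1, hv3⟩ = ![1, 1, 0] := by
    funext i; fin_cases i <;> rfl
  have E4 : Function.update (0 : Fin 3 → Fin 2) 1 ⟨(((0 : Fin 3 → Fin 2) 1 : Fin 2) : ℕ) + 1, hv4⟩ =
      ![0, 1, 0] := by
    funext i; fin_cases i <;> rfl
  have U1 : (if (0 : Fin 3 → Fin 2) = 0 ∧ (0 : Fin 3) = 0 then g₀ else (1 : G)) = g₀ :=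
    if_pos ⟨rfl, rfl⟩
  have U2 : (if (![1, 0, 0] : Fin 3 → Fin 2) = 0 ∧ (1 : Fin 3) = 0 then g₀ else (1 : G)) = 1 :=
    if_neg fun h => absurd h.2 (by decide)
  have U3 : (if (![0, 1, 0] : Fin 3 → Fin 2) = 0 ∧ (0 : Fin 3) = 0 then g₀ else (1 : G)) = 1 :=
    if_neg fun h => absurd h.1 (by decide)
  have U4 : (if (0 : Fin 3 → Fin 2) = 0 ∧ (1 : Fin 3) = 0 then g₀ else (1 : G)) = 1 :=
    if_neg fun h => absurd h.2 (by decide)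
  rw [E1, U1] at h1
  rw [E2, U2, mul_one] at h2
  rw [E3, U3, mul_one] at h3
  rw [E4, U4, mul_one] at h4
  -- the four gauge-transformed links are involutions, hence central, and so is their plaquette product
  have c1 := hJ _ h1
  have c2 := hJ _ h2
  have c3 := hJ _ h3
  have c4 := hJ _ h4
  have hz : (k 0 * g₀ * (k ![1, 0, 0])⁻¹) * (k ![1, 0, 0] * (k ![1, 1, 0])⁻¹) *
      (k ![0, 1, 0] * (k ![1, 1, 0])⁻¹)⁻¹ * (k 0 * (k ![0, 1, 0])⁻¹)⁻¹ ∈ Subgroup.center G :=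
    Subgroup.mul_mem _ (Subgroup.mul_mem _ (Subgroup.mul_mem _ c1 c2) (Subgroup.inv_mem _ c3))
      (Subgroup.inv_mem _ c4)
  have heq : (k 0 * g₀ * (k ![1, 0, 0])⁻¹) * (k ![1, 0, 0] * (k ![1, 1, 0])⁻¹) *
      (k ![0, 1, 0] * (k ![1, 1, 0])⁻¹)⁻¹ * (k 0 * (k ![0, 1, 0])⁻¹)⁻¹ = k 0 * g₀ * (k 0)⁻¹ := by
    group
  rw [heq, conj_mem_center_iff] at hz
  exact hg₀ hz

end Summit.QuantumFields.YangMills.Theorems.BrascampLiebVacuumSC
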